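import Summits.BirchSwinnertonDyer.BirchSwinnertonDyer.Theorems.ThetaPartnerAtTwoSignedKatoUpToAtTwoOffTwoRobust
import HarnessLib

/-!
# K3 `SignedKatoDivisibilityUpToAtTwo` (stmt-BirchSwinnertonDyer-20308), line `colemanrat` v3 — WIDTH SEAT 3 SKETCH
# (bsd-wall-tp2-p2x-w3 g0, 2026-08-27): the PROPOSED TEXT of the ONE `p = 2` research input, in the shape of the print
# and `2`-robust, with its kernel certificate «package + Kato 13.4 (2)@2 + GZK ⇒ K3 BY NAME» (no sorry).

NOT a registered skeleton (the lead owns `Lines/colemanrat.lean`; nothing here is passed to `ledger skeleton check`).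
NOT a tree definition (a `def … : Prop` in a crux workfile, for the planner's promote-stub decision: the lead's
release note asks to promote stub (C2) / the weak package to a first-class conjecture-grade item or to re-line).
BSD is not proved by any of this.

WHAT THE PACKAGE SAYS (all tree vocabulary; compare `Kobayashi2003.SignedColemanKatoData`, the accepted odd-`p`
structure, field by field): on the theta habitat, for the cyclotomic data and a Pollack pair `(L♯, L♭)` at `2`,
there are a pinned `I = 𝐇¹_Γ(T₂E)`, an ABSTRACT `Λ`-module `P` («`(E⁺(k_∞) ⊗ ℚ₂/ℤ₂)^∨` descended along
`Δ = {±1}`»), `ι : P → Λ` («`Col⁺`», kernel killed by `2^m` — field `col`/`col_injective` of the odd structure,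
weakened), `col : 𝐇¹ → P` («`loc₂`»), an exponent `m`, such that
* (PT) for every dual datum `D` of `Sel⁺(E/ℚ_∞)` with `X⁺` torsion: pinned `Y = X₀(E/ℚ_∞)` and `j : P → X⁺`,
  `k : X⁺ → X₀` with `2^m · j ∘ col = 0` (reciprocity) and `2^m · ker k ⊆ range j` (cover) — field `exact` of the
  odd structure ((7.21)), weakened to the two half-exactnesses the upper bound consumes, up to `2^m`, no
  surjectivity of `k`;
* (Z) at every height-one `𝔭 ∌ 2`: some `z` in the `Λ`-span of the GENUINE `2`-adic Euler-system classes
  (`Kato2004.IsEulerSystemClassTwo`) has `ℓ_𝔭(Λ/(ι col z)) ≤ ℓ_𝔭(Λ/(L♭))` — fields `zeta_le_span` +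
  `image_zeta_localized` (`⊇` half) of the odd structure, read with the `2`-adic class predicate and only off `2`.
-/

set_option autoImplicit false
set_option linter.dupNamespace false

noncomputable section

open scoped Classical MatrixGroups ModularForm NumberField

open CongruenceSubgroup WeierstrassCurve Field IsDedekindDomain
  Literature.NumberTheory.GaloisRepresentations
  Literature.NumberTheory.EllipticCurves Literature.NumberTheory.EllipticCurves.ModularForms
  Literature.NumberTheory.EllipticCurves.Module Literature.NumberTheory.EllipticCurves.Rank1Residual
  Literature.NumberTheory.EllipticCurves.Kobayashi2003 Literature.NumberTheory.EllipticCurves.Kato2004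
  Literature.NumberTheory.EllipticCurves.Kato2004.EulerSystemValues ZpExtension
  Summit.BirchSwinnertonDyer.Rank1Residual.Supersingular
  Summit.BirchSwinnertonDyer.BirchSwinnertonDyer.Theorems.SignedKatoOffTwo

namespace Summit.BirchSwinnertonDyer.BirchSwinnertonDyer.Cruxes.SignedKatoDivisibilityUpToAtTwo.ColemanRatW3

/-- **PROPOSED ITEM TEXT (conjecture-grade, research at `p = 2`): the `2`-robust Coleman–Poitou–Tate–zeta package on
the theta habitat, in the shape of the print.** Kobayashi Thm. 6.2/6.3/7.3 ∕ Sprung 2012 Def. 6.1 + §7 READ AT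
`p = 2`, with every `Δ = {±1}`-descent defect allowed (up to `2^m`) and the zeta clause only at the height-one
primes `𝔭 ∌ 2` (where Kato formulates Conj. 12.10 at `p = 2`). Not in print (Sprung 2012 p. 1499 «From now on,
assume p is odd»; Kurihara–Otsuki 2006 p. 557 assert the `a₂ = 0` Coleman map); tree barrier
`SignedIwasawaTheoryAtTwoBarrier` (B3) narrowed to its `𝔭 ∌ 2` part.
[cite: Kobayashi2003, Thm. 6.2–6.3 (p. 11), (7.17)–(7.21), Thm. 7.3 (pp. 12–13)] [cite: Sprung2012, Def. 6.1 (p. 1495), §7 (p. 1499)]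
[cite: Kato2004Asterisque, Thm. 12.5–12.6 (p. 222), Conj. 12.10 (p. 224)] [cite: KuriharaOtsuki2006, p. 557] -/
def RobustZetaSpanPackageTwo : Prop :=
  ∀ (W : WeierstrassCurve ℚ) [W.IsElliptic] [W.IsGloballyMinimal],
    ¬ W.HasCM → W.analyticRank = 0 → GoodSS W 2 → W.frobeniusTrace 2 = 0 →
    ∀ (κ : ZpExtension ℚ 2) (γ : Field.absoluteGaloisGroup ℚ) (hκ : κ.IsCyclotomic),
      κ.IsTopGenerator γ → IsCyclotomicVariable 2 γ →
      ∀ [NeZero (W.conductorNorm ℤ)] (f : CuspForm (Gamma0 (W.conductorNorm ℤ)) 2),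
        IsNewformOf W f → ∀ (ϖ : ℚ), (ϖ : ℝ) * W.realPeriodRat = plusPeriod f →
      ∀ (Lplus Lminus : IwasawaAlgebra 2), IsPollackPair f 2 Lplus Lminus →
      ∀ [ContinuousSMul ℤ_[2] (W.tateModule 2)] [Module.Free ℤ_[2] (W.tateModule 2)]
        [Module.Finite ℤ_[2] (W.tateModule 2)],
      ∃ (I : Kato2004.IwasawaH1Data W 2 κ γ)
        (P : Type) (_ : AddCommGroup P) (_ : _root_.Module (IwasawaAlgebra 2) P)
        (ι : P →ₗ[IwasawaAlgebra 2] IwasawaAlgebra 2) (col : I.H →ₗ[IwasawaAlgebra 2] P) (m : ℕ),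
        (∀ y, ι y = 0 → (PowerSeries.C (2 : ℤ_[2]) : IwasawaAlgebra 2) ^ m • y = 0) ∧
        (∀ (D : SignedSelmerDualData W κ γ 1), Module.IsTorsion (IwasawaAlgebra 2) D.X →
          ∃ (Y : W.FineSelmerDualData κ γ) (j : P →ₗ[IwasawaAlgebra 2] D.X)
            (k : D.X →ₗ[IwasawaAlgebra 2] Y.X),
            (∀ x, (PowerSeries.C (2 : ℤ_[2]) : IwasawaAlgebra 2) ^ m • j (col x) = 0) ∧
            (∀ x, k x = 0 → (PowerSeries.C (2 : ℤ_[2]) : IwasawaAlgebra 2) ^ m • x ∈ LinearMap.range j)) ∧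
        (∀ 𝔭 : PrimeSpectrum (IwasawaAlgebra 2), 𝔭.asIdeal.height = 1 →
          PowerSeries.C (2 : ℤ_[2]) ∉ 𝔭.asIdeal →
          ∃ z ∈ Submodule.span (IwasawaAlgebra 2) {g : I.H | Kato2004.IsEulerSystemClassTwo W hκ I g},
            lengthAt (IwasawaAlgebra 2) (IwasawaAlgebra 2 ⧸ Ideal.span {ι (col z)}) 𝔭 ≤
              lengthAt (IwasawaAlgebra 2) (IwasawaAlgebra 2 ⧸ Ideal.span {kobayashiL 1 Lplus Lminus}) 𝔭)

/-- **Kernel certificate: the proposed package + Kato Thm. 13.4 (2) at `p = 2` (named fact) + Gross–Zagier–Kolyvagin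
(named fact) ⇒ K3 BY NAME** (tree theorem `signedKatoDivisibilityUpToAtTwo_of_robustZetaSpanPackageTwo_of_pub`,
p578418). [cite: Kato2004Asterisque, Thm. 13.4 (2) (p. 226)] [cite: Darmon2004, Thm. 3.22] -/
theorem signedKatoDivisibilityUpToAtTwo_of_package
    (h134 : Kato2004.thm13_4_two_lengthAt_fineSelmerDual_le_of_isEulerSystemClassTwo)
    (h17 : rank_eq_analyticRank_of_analyticRank_le_one) (hPkg : RobustZetaSpanPackageTwo) :
    Summit.BirchSwinnertonDyer.BirchSwinnertonDyer.Theses.ThetaPartnerAtTwo.SignedKatoDivisibilityUpToAtTwo :=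
  signedKatoDivisibilityUpToAtTwo_of_robustZetaSpanPackageTwo_of_pub h134 h17 hPkg

end Summit.BirchSwinnertonDyer.BirchSwinnertonDyer.Cruxes.SignedKatoDivisibilityUpToAtTwo.ColemanRatW3

end
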